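import Summits.CriticalPhenomena.CardyFormulaZ2.Theses.CardyIKTransport
import Literature.Probability.Percolation.QuadCrossingSquareModel
import Literature.Probability.RandomPlanarGeometry.ConformalRectangleProofs
import Literature.Probability.RandomPlanarGeometry.CardyFunctionIncBeta

/-!
# `RenewalGridHarmless` (stmt-CriticalPhenomena-4967): the antecedent is void on gapped product
# grids; the item holds (vacuously) for every asymptotic density `a > 2`

Route `CardyIKTransport`, support item `RenewalGridHarmless` (B2.6 / F2):
`∀ a s t, 0 < a → StrictMono s → StrictMono t → s i / i → a → t i / i → a →
(∀ R, Cardy for the crude event of bond-ℤ² drawn on the product grid z v = (s v₀, t v₁)) →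
(∀ R, Cardy for the crude event on the standard embedding)`.

This helper file records the part of the item that is settled by the SHAPE of the crude event
`embDomainCrossing` (all vertices in the open carrier, endpoints within the fixed slack `2δ` of the
arcs), with no percolation estimate:

* `embDomainCrossing_rect_eq_empty_of_gap` — in the witness rectangle `R₁ = (0,1) × (1,2)` (arc `0`
  = bottom side `[0,1] × {1}`, `rectQuad`), at mesh `δ = 1 / t j` the crude event of the product
  grid is EMPTY as soon as `t (j+1) > t j + 2`: a start vertex `u` must satisfy
  `1 < t (u 1) / t j` (inside the carrier) and `t (u 1) / t j - 1 ≤ 2 / t j` (within `2δ` of the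
  bottom side), i.e. `t j < t (u 1) ≤ t j + 2 < t (j + 1)`, impossible for a strictly increasing `t`.
* `not_hasCrossingLimit_rect_of_gaps` — hence, if such gaps occur at arbitrarily large heights
  `t j`, the crude crossing probabilities of `R₁` vanish along a sequence of meshes `→ 0⁺` and
  cannot tend to `F(η) > 0` (`η ∈ (0,1)` the modulus of `R₁`, uniformizing data exist by
  `exists_isUniformizing_holds`, `F > 0` on `(0,1)` by `strictMonoOn_cardyFunction_holds`): the
  antecedent `∀ R, HasCrossingLimit …` of the item FAILS for such grids.
* `exists_gap_of_two_lt` — if `t i / i → a` with `a > 2` then gaps `> 2` occur at arbitrarily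
  large heights (else `t (i₀ + n) ≤ t i₀ + 2 n`, contradicting `t i > b i` for a `b ∈ (2, a)`).
* `renewalGridHarmless_of_two_lt` — COROLLARY: the item's implication holds for every `a > 2`
  (its antecedent is false). In particular it holds, vacuously, on almost every renewal grid with
  unbounded gap distribution — the grids the item is named after (cf. the hazard note in the route
  file, item #5: "its antecedent is a.s. never met by unbounded-gap grids because of the 2δ slack").

What is NOT here: the bounded-gap case `a ≤ 2` (the live content: slack-rescaling `2δ/a ↔ 2δ` and
`o(1)`-distortion robustness of crude Cardy limits over all Jordan rectangles), pursued in sibling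
files. References: route file `Theses/CardyIKTransport.lean` (item stmt-4967 and note #5);
G. Grimmett, I. Manolescu, PTRF 159 (2014) §2.2 (embedded crossing events); the tree's
`QuadCrossingSquareModel.lean` (`rectQuad`).
-/

noncomputable section

namespace Summit.CriticalPhenomena.CardyFormulaZ2.Theorems.CardyIKTransport.RenewalGridHarmless

open Filter Set Metric MeasureTheory
open scoped Topology
open Literature.Probability.Percolation hiding cardyFunction
open Literature.Probability.LatticeModels
open Literature.Probability.RandomPlanarGeometry

/-- The witness rectangle `R₁ = (0,1) × (1,2)`, corners marked counterclockwise from `i`; its arc `0`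
is the bottom side `[0,1] × {1}` and its arc `2` the top side. -/
local notation "R₁" => (rectQuad (0 : ℝ) 1 1 2 zero_lt_one one_lt_two)

/-- The imaginary part of a real multiple of `⟨x, y⟩` is the multiple of `y`. [folklore] -/
theorem im_ofReal_mul_mk (δ x y : ℝ) : ((δ : ℂ) * (⟨x, y⟩ : ℂ)).im = δ * y := by
  simp [Complex.mul_im]

/-- Points of the carrier of `R₁` are at distance at least `im q - 1` from its bottom side (arc `0`).
[folklore] -/
theorem im_sub_one_le_infDist_arc_zero (q : ℂ) : q.im - 1 ≤ infDist q ((R₁).arc 0) := by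
  refine (le_infDist ⟨_, MarkedDomain.pt_mem_arc_self _ 0⟩).2 fun y hy => ?_
  rw [mem_rectQuad_arc_zero] at hy
  calc q.im - 1 = (q - y).im := by simp [hy.1]
    _ ≤ |(q - y).im| := le_abs_self _
    _ ≤ ‖q - y‖ := Complex.abs_im_le_norm _
    _ = dist q y := (dist_eq_norm q y).symm

/-- **The crude event is empty at a gap.** On the product grid `z v = (s v₀, t v₁)` with `t` strictly
increasing, `0 < t j` and `t j + 2 < t (j + 1)`, the crude crossing event of `R₁ = (0,1) × (1,2)` at
mesh `1 / t j` is empty: no vertex lies in the carrier within `2δ` of the bottom side. [folklore] -/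
theorem embDomainCrossing_rect_eq_empty_of_gap (s : ℤ → ℝ) {t : ℤ → ℝ} (ht : StrictMono t) {j : ℤ}
    (hj : 0 < t j) (hgap : t j + 2 < t (j + 1)) :
    embDomainCrossing (fun v : Site 2 ↦ (⟨s (v 0), t (v 1)⟩ : ℂ)) (R₁).carrier (1 / t j)
      ((R₁).arc 0) ((R₁).arc 2) = ∅ := by
  ext ω
  simp only [mem_empty_iff_false, iff_false]
  intro hω
  rw [mem_embDomainCrossing_iff] at hω
  obtain ⟨u, hu, v, -, hconn⟩ := hω
  obtain ⟨huS, -, -⟩ := hconn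
  rw [mem_setOf_eq, mem_rectQuad_carrier] at huS
  have him := im_ofReal_mul_mk (1 / t j) (s (u 0)) (t (u 1))
  have hdist := (im_sub_one_le_infDist_arc_zero _).trans hu
  rw [him] at hdist huS
  obtain ⟨-, h1, -⟩ := huS
  -- `t j < t (u 1)`
  have hlow : t j < t (u 1) := by
    have : 1 * t j < 1 / t j * t (u 1) * t j := mul_lt_mul_of_pos_right h1 hj
    simpa [div_mul_eq_mul_div, mul_assoc, mul_comm, hj.ne'] using this
  -- `t (u 1) ≤ t j + 2`
  have hup : t (u 1) ≤ t j + 2 := by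
    have : (1 / t j * t (u 1) - 1) * t j ≤ 2 * (1 / t j) * t j :=
      mul_le_mul_of_nonneg_right hdist hj.le
    have e1 : (1 / t j * t (u 1) - 1) * t j = t (u 1) - t j := by field_simp
    have e2 : 2 * (1 / t j) * t j = 2 := by field_simp
    rw [e1, e2] at this
    linarith
  have h1' : j < u 1 := ht.lt_iff_lt.1 hlow
  have h2' : u 1 < j + 1 := ht.lt_iff_lt.1 (hup.trans_lt hgap)
  omega

/-- **The antecedent of `RenewalGridHarmless` fails on gapped grids.** If `t` is strictly increasing
and has gaps `t (j+1) > t j + 2` at arbitrarily large heights `t j`, then the crude crossing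
probabilities of `R₁` on the product grid `(s v₀, t v₁)` do NOT have the Cardy limit: they vanish at
the meshes `1 / t j → 0⁺` (`embDomainCrossing_rect_eq_empty_of_gap`), whereas `F(η_{R₁}) > 0`.
[folklore] -/
theorem not_hasCrossingLimit_rect_of_gaps (s : ℤ → ℝ) {t : ℤ → ℝ} (ht : StrictMono t)
    (hgap : ∀ M : ℝ, ∃ j : ℤ, M < t j ∧ t j + 2 < t (j + 1)) :
    ¬ (R₁).HasCrossingLimit (fun δ ↦ (bondPercolation (zdGraph 2) half).real
        (embDomainCrossing (fun v : Site 2 ↦ (⟨s (v 0), t (v 1)⟩ : ℂ)) (R₁).carrier δ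
          ((R₁).arc 0) ((R₁).arc 2))) cardyFunction := by
  intro H
  obtain ⟨φ, x, hφx⟩ := MarkedDomain.exists_isUniformizing_holds (R₁)
  have hT := H φ x hφx
  have hη := ConformalRectangle.crossRatio_mem_Ioo_of_isUniformizing hφx
  have hF : 0 < cardyFunction (crossRatio x) := by
    have h0 := strictMonoOn_cardyFunction_holds ⟨le_rfl, zero_le_one⟩ ⟨hη.1.le, hη.2.le⟩ hη.1
    rwa [cardyFunction_zero] at h0
  have hev : ∀ᶠ δ in 𝓝[>] (0 : ℝ), cardyFunction (crossRatio x) / 2 <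
      (bondPercolation (zdGraph 2) half).real
        (embDomainCrossing (fun v : Site 2 ↦ (⟨s (v 0), t (v 1)⟩ : ℂ)) (R₁).carrier δ
          ((R₁).arc 0) ((R₁).arc 2)) :=
    hT.eventually (lt_mem_nhds (half_lt_self hF))
  rw [eventually_nhdsWithin_iff, Metric.eventually_nhds_iff] at hev
  obtain ⟨ε, hε, hball⟩ := hev
  obtain ⟨j, hj, hjgap⟩ := hgap (1 / ε)
  have htj : 0 < t j := (one_div_pos.2 hε).trans hj
  have hδ : dist (1 / t j) (0 : ℝ) < ε := by
    rw [dist_zero_right, Real.norm_eq_abs, abs_of_pos (one_div_pos.2 htj)]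
    exact (one_div_lt htj hε).2 hj
  have := hball hδ (one_div_pos.2 htj)
  rw [embDomainCrossing_rect_eq_empty_of_gap s ht htj hjgap, measureReal_empty] at this
  linarith

/-- The ratio limit along `cocompact ℤ` restricts to `atTop`. [folklore] -/
theorem tendsto_atTop_of_tendsto_cocompact {f : ℤ → ℝ} {a : ℝ}
    (h : Tendsto f (cocompact ℤ) (𝓝 a)) : Tendsto f atTop (𝓝 a) :=
  h.mono_left (by rw [cocompact_eq_cofinite, Int.cofinite_eq]; exact le_sup_right)

/-- **Density `a > 2` forces gaps `> 2` at arbitrarily large heights.** If `t i / i → a > 2` as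
`i → +∞` then for every `M` there is `j` with `M < t j` and `t j + 2 < t (j + 1)`: otherwise, from
some `i₀` on, `t (i₀ + n) ≤ t i₀ + 2 n`, contradicting `t i > b i` for a fixed `b ∈ (2, a)`. [folklore] -/
theorem exists_gap_of_two_lt {t : ℤ → ℝ} {a : ℝ} (ha : 2 < a)
    (hta : Tendsto (fun i : ℤ => t i / (i : ℝ)) atTop (𝓝 a)) (M : ℝ) :
    ∃ j : ℤ, M < t j ∧ t j + 2 < t (j + 1) := by
  by_contra hno
  push Not at hno
  set b : ℝ := (a + 2) / 2 with hb
  have hb2 : 2 < b := by rw [hb]; linarith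
  have hba : b < a := by rw [hb]; linarith
  have hbpos : 0 < b := by linarith
  -- eventually `b < t i / i`
  have hev : ∀ᶠ i : ℤ in atTop, b < t i / (i : ℝ) := hta.eventually (lt_mem_nhds hba)
  rw [eventually_atTop] at hev
  obtain ⟨i₁, hi₁⟩ := hev
  -- a threshold `i₂ ≥ i₁`, `≥ 1`, `> M / b`
  set i₂ : ℤ := max i₁ (max 1 (⌈M / b⌉ + 1)) with hi₂
  have hi₂i₁ : i₁ ≤ i₂ := le_max_left _ _
  have hi₂one : (1 : ℤ) ≤ i₂ := (le_max_left _ _).trans (le_max_right _ _)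
  have hi₂M : M / b < (i₂ : ℝ) := by
    have h1 : ⌈M / b⌉ + 1 ≤ i₂ := (le_max_right _ _).trans (le_max_right _ _)
    have h2 : ((⌈M / b⌉ + 1 : ℤ) : ℝ) ≤ (i₂ : ℝ) := by exact_mod_cast h1
    push_cast at h2
    linarith [Int.le_ceil (M / b)]
  have hMb : M < b * (i₂ : ℝ) := by rwa [div_lt_iff₀ hbpos, mul_comm] at hi₂M
  -- the lower bound `b (i₂ + n) < t (i₂ + n)` at all later indices
  have hlowb : ∀ n : ℕ, b * ((i₂ : ℝ) + n) < t (i₂ + n) := by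
    intro n
    have hidx : i₁ ≤ i₂ + n := hi₂i₁.trans (by omega)
    have hpos : (0 : ℝ) < (i₂ : ℝ) + n := by
      have : (1 : ℝ) ≤ i₂ := by exact_mod_cast hi₂one
      have hn0 : (0 : ℝ) ≤ n := n.cast_nonneg
      linarith
    have := hi₁ (i₂ + n) hidx
    push_cast at this
    rwa [lt_div_iff₀ hpos] at this
  -- hence `M < t (i₂ + n)` and, by `hno`, consecutive gaps are `≤ 2`
  have hstep : ∀ n : ℕ, t (i₂ + n + 1) ≤ t (i₂ + n) + 2 := by
    intro n
    refine hno (i₂ + n) ?_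
    have h1 := hlowb n
    have hn0 : (0 : ℝ) ≤ n := n.cast_nonneg
    nlinarith
  have hind : ∀ n : ℕ, t (i₂ + n) ≤ t i₂ + 2 * n := by
    intro n
    induction n with
    | zero => simp
    | succ n ih =>
      have := hstep n
      push_cast
      have e : i₂ + ((n : ℤ) + 1) = i₂ + n + 1 := by ring
      rw [e]
      linarith
  -- contradiction for `n` large: `(b - 2) n < t i₂ - b i₂`
  obtain ⟨n, hn⟩ := exists_nat_gt ((t i₂ - b * i₂) / (b - 2))
  have h1 := hlowb n
  have h2 := hind n
  rw [div_lt_iff₀ (by linarith)] at hn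
  nlinarith

/-- **`RenewalGridHarmless` holds for every asymptotic density `a > 2`** (vacuously: its
antecedent fails in the rectangle `R₁`, `not_hasCrossingLimit_rect_of_gaps` with
`exists_gap_of_two_lt`). Same binder shape as the route decl, with `0 < a` strengthened to `2 < a`;
the hypotheses on `s` are not used. [folklore] -/
theorem renewalGridHarmless_of_two_lt (a : ℝ) (s t : ℤ → ℝ) (ha : 2 < a) (_hs : StrictMono s)
    (ht : StrictMono t)
    (_hsa : Tendsto (fun i : ℤ => s i / (i : ℝ)) (cocompact ℤ) (𝓝 a))
    (hta : Tendsto (fun i : ℤ => t i / (i : ℝ)) (cocompact ℤ) (𝓝 a))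
    (H : ∀ R : ConformalRectangle, R.HasCrossingLimit (fun δ ↦ (bondPercolation (zdGraph 2)
      half).real (embDomainCrossing (fun v : Site 2 ↦ (⟨s (v 0), t (v 1)⟩ : ℂ)) R.carrier δ
        (R.arc 0) (R.arc 2))) cardyFunction) :
    ∀ R : ConformalRectangle, R.HasCrossingLimit (fun δ ↦ (bondPercolation (zdGraph 2)
      half).real (embDomainCrossing squareLatticeEmbedding.z R.carrier δ (R.arc 0) (R.arc 2)))
        cardyFunction :=
  absurd (H (R₁)) (not_hasCrossingLimit_rect_of_gaps s ht
    (exists_gap_of_two_lt ha (tendsto_atTop_of_tendsto_cocompact hta)))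

end Summit.CriticalPhenomena.CardyFormulaZ2.Theorems.CardyIKTransport.RenewalGridHarmless

end
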